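import Literature.Probability.Percolation.TriLatticeRounding
import Literature.Probability.LatticeModels.DelaunayGraph
import Mathlib.Topology.MetricSpace.Thickening
import HarnessLib

/-!
# Voronoi cells of the triangular mesh and lattice paths shadowing planar continua

Topic `Literature/Probability/Percolation`; family `crit-perc`. The closed Voronoi cells
`voronoiCell (range (triMeshPoint δ)) (triMeshPoint δ v)` (`DelaunayGraph.lean`) of the sites of
the rescaled triangular lattice `δ𝕋 ⊆ ℂ` (geometrically: the closed hexagons of the dual
honeycomb lattice, Bollobás–Riordan, *Percolation* (2006), Ch. 5 §5.1, Figure 2: "site percolation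
on the triangular lattice … as a colouring of the hexagonal faces"), with exactly the properties
needed to read a lattice path off a planar continuum:

* `isClosed_triVoronoiCell`, `exists_mem_triVoronoiCell` (the cells cover the plane),
  `dist_le_of_mem_triVoronoiCell` (a cell lies within `0.7 δ` of its site; the true
  circumradius is `δ/√3`), `eq_or_adj_of_mem_triVoronoiCell` (**two cells meet only if their
  sites are equal or adjacent**: their sites are then `< √3 δ` apart),
  `finite_setOf_inter_triVoronoiCell_nonempty` (finitely many cells meet a bounded set);
* `reflTransGen_of_isPreconnected_of_finite_cover` — a finite closed cover of a preconnected set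
  is chain-connected through points of the set (the closed twin of
  `Literature.Topology.IsPreconnected.reflTransGen_of_subset_iUnion`);
* `exists_pathIn_of_subset_triVoronoiCell` — **the lattice path of a continuum**: if a bounded
  preconnected `S ⊆ ℂ` is covered by the cells of the sites of `T`, any two points of `S` lie in
  cells of sites `u`, `w ∈ T` joined by a `𝕋`-path of sites of `T` whose cells meet `S`.  This is
  the step "a connected monochromatic set of hexagons contains a path of hexagons" of every
  continuum-to-lattice argument (e.g. Bollobás–Riordan 2006, Ch. 7, proof of Thm. 2, p. 199).

## References

* B. Bollobás, O. Riordan, *Percolation*, Cambridge University Press (2006), Ch. 5 §5.1, Ch. 7.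

## Mathlib / tree

Mathlib: `isPreconnected_closed_iff`, `Set.Finite.isClosed_biUnion`, `Set.exists_min_image`,
`Metric.mem_cthickening_of_dist_le`. Tree: `voronoiCell` (`DelaunayGraph.lean`),
`exists_dist_triMeshPoint_le`, `eq_or_adj_of_dist_triMeshPoint_lt` (`TriLatticeRounding.lean`),
`triMeshVertices_finite_holds` (`TriangularLatticeProofs.lean`), `PathIn` (`SitePaths.lean`).
-/

noncomputable section

open Set Metric

namespace Literature.Probability.Percolation

open LatticeModels

/-! ### Voronoi cells of `δ𝕋` -/

/-- Membership in the Voronoi cell of the site `v` of `δ𝕋`: the mesh point of `v` is a nearest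
mesh point. [folklore] -/
theorem mem_triVoronoiCell_iff {δ : ℝ} {v : Site 2} {p : ℂ} :
    p ∈ voronoiCell (range (triMeshPoint δ)) (triMeshPoint δ v) ↔
      ∀ w : Site 2, dist p (triMeshPoint δ v) ≤ dist p (triMeshPoint δ w) := by
  simp only [mem_voronoiCell_iff, mem_range, forall_exists_index, forall_apply_eq_imp_iff]

/-- The Voronoi cells of `δ𝕋` are closed. [folklore] -/
theorem isClosed_triVoronoiCell (δ : ℝ) (v : Site 2) :
    IsClosed (voronoiCell (range (triMeshPoint δ)) (triMeshPoint δ v)) := by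
  have e : voronoiCell (range (triMeshPoint δ)) (triMeshPoint δ v) =
      ⋂ w : Site 2, {p : ℂ | dist p (triMeshPoint δ v) ≤ dist p (triMeshPoint δ w)} := by
    ext p; rw [mem_triVoronoiCell_iff, mem_iInter]; rfl
  rw [e]
  exact isClosed_iInter fun w =>
    isClosed_le (continuous_id.dist continuous_const) (continuous_id.dist continuous_const)

/-- The mesh point of a site lies in its cell. [folklore] -/
theorem triMeshPoint_mem_triVoronoiCell (δ : ℝ) (v : Site 2) :
    triMeshPoint δ v ∈ voronoiCell (range (triMeshPoint δ)) (triMeshPoint δ v) :=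
  self_mem_voronoiCell _ _

/-- **A cell lies within `0.7 δ` of its site** (every point of the plane is within `0.7 δ` of some
mesh point). [folklore] -/
theorem dist_le_of_mem_triVoronoiCell {δ : ℝ} (hδ : 0 < δ) {v : Site 2} {p : ℂ}
    (hp : p ∈ voronoiCell (range (triMeshPoint δ)) (triMeshPoint δ v)) :
    dist p (triMeshPoint δ v) ≤ 7 / 10 * δ := by
  obtain ⟨a, ha⟩ := exists_dist_triMeshPoint_le hδ p
  exact ((mem_triVoronoiCell_iff.1 hp) a).trans ha

/-- **The cells cover the plane**: every point has a nearest mesh point (there are finitely many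
mesh points within `0.7 δ`, and at least one). [folklore] -/
theorem exists_mem_triVoronoiCell {δ : ℝ} (hδ : 0 < δ) (p : ℂ) :
    ∃ v : Site 2, p ∈ voronoiCell (range (triMeshPoint δ)) (triMeshPoint δ v) := by
  set N : Set (Site 2) := {w | dist p (triMeshPoint δ w) ≤ 7 / 10 * δ} with hN
  have hfin : N.Finite := by
    refine (triMeshVertices_finite_holds (Ω := closedBall p (7 / 10 * δ)) isBounded_closedBall hδ).subset ?_
    intro w hw
    rw [mem_triMeshVertices_iff, mem_closedBall, dist_comm]
    exact hw
  obtain ⟨a, ha⟩ := exists_dist_triMeshPoint_le hδ p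
  obtain ⟨v, hv, hmin⟩ := N.exists_min_image (fun w => dist p (triMeshPoint δ w)) hfin ⟨a, ha⟩
  refine ⟨v, mem_triVoronoiCell_iff.2 fun w => ?_⟩
  by_cases hw : w ∈ N
  · exact hmin w hw
  · have hw' : 7 / 10 * δ < dist p (triMeshPoint δ w) := not_le.1 hw
    exact (show dist p (triMeshPoint δ v) ≤ 7 / 10 * δ from hv).trans hw'.le

/-- **Two cells meet only if their sites are equal or adjacent**: a common point is within
`0.7 δ` of both sites, which are then `< √3 δ` apart. [folklore] -/
theorem eq_or_adj_of_mem_triVoronoiCell {δ : ℝ} (hδ : 0 < δ) {v w : Site 2} {p : ℂ}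
    (hv : p ∈ voronoiCell (range (triMeshPoint δ)) (triMeshPoint δ v))
    (hw : p ∈ voronoiCell (range (triMeshPoint δ)) (triMeshPoint δ w)) : v = w ∨ triGraph.Adj v w := by
  apply eq_or_adj_of_dist_triMeshPoint_lt hδ
  have h1 := dist_le_of_mem_triVoronoiCell hδ hv
  have h2 := dist_le_of_mem_triVoronoiCell hδ hw
  have h3 : (17 : ℝ) / 10 < Real.sqrt 3 := by
    rw [Real.lt_sqrt (by norm_num)]; norm_num
  rw [dist_comm] at h1
  calc dist (triMeshPoint δ v) (triMeshPoint δ w)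
      ≤ dist (triMeshPoint δ v) p + dist p (triMeshPoint δ w) := dist_triangle _ _ _
    _ ≤ 7 / 10 * δ + 7 / 10 * δ := add_le_add h1 h2
    _ < Real.sqrt 3 * δ := by nlinarith

/-- **Finitely many cells meet a bounded set.** [folklore] -/
theorem finite_setOf_inter_triVoronoiCell_nonempty {δ : ℝ} (hδ : 0 < δ) {S : Set ℂ}
    (hS : Bornology.IsBounded S) :
    {v : Site 2 | (S ∩ voronoiCell (range (triMeshPoint δ)) (triMeshPoint δ v)).Nonempty}.Finite := by
  refine (triMeshVertices_finite_holds (Ω := cthickening (7 / 10 * δ) S) hS.cthickening hδ).subset ?_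
  rintro v ⟨s, hsS, hsv⟩
  rw [mem_triMeshVertices_iff]
  exact mem_cthickening_of_dist_le _ s _ _ hsS (by rw [dist_comm]; exact dist_le_of_mem_triVoronoiCell hδ hsv)

/-! ### A finite closed cover of a connected set is chain-connected -/

/-- **A finite closed cover of a preconnected set is chain-connected through the set**: if `S` is
preconnected, `S ⊆ ⋃ i ∈ F, A i` with `F` finite and the `A i` closed, and `S` meets `A i₀` and
`A i₁` (`i₀, i₁ ∈ F`), then `i₀`, `i₁` are joined by a chain in `F` along which consecutive sets
have a common point in `S`.  (The union of the members reachable from `i₀` and the union of the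
other members are closed and cover `S`; `isPreconnected_closed_iff`.) [folklore] -/
theorem reflTransGen_of_isPreconnected_of_finite_cover {X ι : Type*} [TopologicalSpace X]
    {S : Set X} (hS : IsPreconnected S) {F : Set ι} (hF : F.Finite) {A : ι → Set X}
    (hA : ∀ i ∈ F, IsClosed (A i)) (hcov : S ⊆ ⋃ i ∈ F, A i) {i₀ i₁ : ι} (hi₀ : i₀ ∈ F)
    (h₀ : (S ∩ A i₀).Nonempty) (hi₁ : i₁ ∈ F) (h₁ : (S ∩ A i₁).Nonempty) :
    Relation.ReflTransGen (fun i j => i ∈ F ∧ j ∈ F ∧ (S ∩ A i ∩ A j).Nonempty) i₀ i₁ := by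
  classical
  set R : ι → ι → Prop := fun i j => i ∈ F ∧ j ∈ F ∧ (S ∩ A i ∩ A j).Nonempty with hR
  by_contra hcon
  set U₁ : Set X := ⋃ i ∈ {i | i ∈ F ∧ Relation.ReflTransGen R i₀ i}, A i with hU₁
  set U₂ : Set X := ⋃ i ∈ {i | i ∈ F ∧ ¬ Relation.ReflTransGen R i₀ i}, A i with hU₂
  have hU₁c : IsClosed U₁ := (hF.subset fun i hi => hi.1).isClosed_biUnion fun i hi => hA i hi.1
  have hU₂c : IsClosed U₂ := (hF.subset fun i hi => hi.1).isClosed_biUnion fun i hi => hA i hi.1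
  have hcover : S ⊆ U₁ ∪ U₂ := by
    intro p hp
    obtain ⟨i, hi, hpi⟩ := mem_iUnion₂.1 (hcov hp)
    by_cases h : Relation.ReflTransGen R i₀ i
    · exact Or.inl (mem_iUnion₂.2 ⟨i, ⟨hi, h⟩, hpi⟩)
    · exact Or.inr (mem_iUnion₂.2 ⟨i, ⟨hi, h⟩, hpi⟩)
  have hm₁ : (S ∩ U₁).Nonempty := by
    obtain ⟨p, hpS, hp⟩ := h₀
    exact ⟨p, hpS, mem_iUnion₂.2 ⟨i₀, ⟨hi₀, Relation.ReflTransGen.refl⟩, hp⟩⟩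
  have hm₂ : (S ∩ U₂).Nonempty := by
    obtain ⟨p, hpS, hp⟩ := h₁
    exact ⟨p, hpS, mem_iUnion₂.2 ⟨i₁, ⟨hi₁, hcon⟩, hp⟩⟩
  obtain ⟨p, hpS, hp₁, hp₂⟩ := (isPreconnected_closed_iff.1 hS) U₁ U₂ hU₁c hU₂c hcover hm₁ hm₂
  obtain ⟨i, hi, hpi⟩ := mem_iUnion₂.1 hp₁
  obtain ⟨j, hj, hpj⟩ := mem_iUnion₂.1 hp₂
  exact hj.2 (hi.2.tail ⟨hi.1, hj.1, p, ⟨hpS, hpi⟩, hpj⟩)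

/-! ### The lattice path of a continuum covered by cells -/

/-- **The lattice path of a continuum.**  Let `S ⊆ ℂ` be bounded and preconnected, covered by the
Voronoi cells of the sites of `T`.  Then any two points `p, q ∈ S` lie in the cells of sites
`u, w ∈ T` joined by a path of `𝕋` through sites of `T` whose cells meet `S` (consecutive cells
of the chain of `reflTransGen_of_isPreconnected_of_finite_cover` share a point, so their sites are
equal or adjacent).  [cite: BollobasRiordan2006, Ch. 7 proof of Thm. 2 p. 199] -/
theorem exists_pathIn_of_subset_triVoronoiCell {δ : ℝ} (hδ : 0 < δ) {S : Set ℂ}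
    (hS : IsPreconnected S) (hSb : Bornology.IsBounded S) {T : Set (Site 2)}
    (hcov : S ⊆ ⋃ v ∈ T, voronoiCell (range (triMeshPoint δ)) (triMeshPoint δ v)) {p q : ℂ}
    (hp : p ∈ S) (hq : q ∈ S) :
    ∃ u w : Site 2, p ∈ voronoiCell (range (triMeshPoint δ)) (triMeshPoint δ u) ∧
      q ∈ voronoiCell (range (triMeshPoint δ)) (triMeshPoint δ w) ∧
      PathIn triGraph {v | v ∈ T ∧ (S ∩ voronoiCell (range (triMeshPoint δ)) (triMeshPoint δ v)).Nonempty} u w := by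
  set cell : Site 2 → Set ℂ := fun v => voronoiCell (range (triMeshPoint δ)) (triMeshPoint δ v) with hcell
  set F : Set (Site 2) := {v | v ∈ T ∧ (S ∩ cell v).Nonempty} with hF
  have hFfin : F.Finite := (finite_setOf_inter_triVoronoiCell_nonempty hδ hSb).subset fun v hv => hv.2
  have hcovF : S ⊆ ⋃ v ∈ F, cell v := by
    intro s hs
    obtain ⟨v, hv, hsv⟩ := mem_iUnion₂.1 (hcov hs)
    exact mem_iUnion₂.2 ⟨v, ⟨hv, s, hs, hsv⟩, hsv⟩
  obtain ⟨u, hu, hpu⟩ := mem_iUnion₂.1 (hcovF hp)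
  obtain ⟨w, hw, hqw⟩ := mem_iUnion₂.1 (hcovF hq)
  have hchain := reflTransGen_of_isPreconnected_of_finite_cover hS hFfin
    (fun v _ => isClosed_triVoronoiCell δ v) hcovF hu ⟨p, hp, hpu⟩ hw ⟨q, hq, hqw⟩
  refine ⟨u, w, hpu, hqw, ?_⟩
  clear hpu hqw hw
  induction hchain with
  | refl => exact PathIn.refl hu
  | tail _ hst ih =>
    obtain ⟨hsF, htF, x, ⟨-, hxs⟩, hxt⟩ := hst
    exact ih.trans (PathIn.of_eq_or_adj hsF htF (eq_or_adj_of_mem_triVoronoiCell hδ hxs hxt))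

end Literature.Probability.Percolation

end
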